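import Literature.Probability.LatticeModels.CriticalBlockMoments
import Literature.Probability.LatticeModels.RescaledUrsellUniformOnCompact

/-!
# A Gaussian pointwise limit kills the block Binder coupling (stub `stub_gaussianKillsBinder`)

Crux `CoulombImpliesNontrivial` of route `PerfectScreening` (Ising3DConformalLimit), line `SketchPub`,
registered stub S7. With `M_L = Σ_{x ∈ box 3 L} σ_x`, `Σ_L = ⟨M_L²⟩_{β_c}`, `Q_L = ⟨M_L⁴⟩_{β_c}`: if
`c L⁵ ≤ Σ_L ≤ C L⁵` (`L ≥ 1`) and `(ρ, S)` is a non-degenerate pointwise scaling limit of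
`criticalCorr 3` with `U₄^S ≡ 0` on non-coincident configurations, then the block Binder coupling
`g_L = (3Σ_L² - Q_L)/Σ_L² → 0`.

Proof. `3Σ_L² - Q_L = -Σ_{Λ_L⁴} U₄^{lat}` (`three_mul_sq_sub_fourth_eq_neg_sum_ursellFour`). Split
`Λ_L⁴` at sup-distance `n = ⌊ηL⌋`: the near part is `≤ 12|Λ_L|(1 + C₀(n+1)²)Σ_L`
(`gkb_sum_abs_ursellFour_le_near_add_far`: `|U₄| ≤ 2⟨σσ⟩⟨σσ⟩` for the pairing of the close pair
and the infrared bound on row sums), which is `≤ (ε/2)Σ_L²` once `η² ≲ ε c` and `L² ≳ 1/(εc)`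
because `Σ_L ≥ cL⁵`; on the far part `ρ(1/L)⁴|U₄^{lat}| ≤ ε'` uniformly for large `L`
(`eventually_forall_far_rescaled_ursellFour_le`: uniform convergence to `U₄^S = 0` on the compact set
of `η`-separated rescaled configurations) while `ρ(1/L)⁻⁴ ≤ K₁²/L²`
(`exists_eventually_inv_sq_rho_le`, from `S₂ > 0` and the infrared bound), so the far part is
`≤ |Λ_L|⁴ ε' K₁²/L² ≤ 27⁴ ε' K₁² L¹⁰ ≤ (ε/4)Σ_L²`.
-/

noncomputable section

namespace Summit.CriticalPhenomena.Ising3DConformalLimit.PerfectScreeningCoulombImpliesNontrivial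

open Literature.Probability.LatticeModels Filter Set Finset
open scoped Topology BigOperators

/-- The real arithmetic of the near/far assembly: with `N ≤ 27L³` sites, near radius `n ≤ ηL`,
block variance `S ≥ cL⁵`, near constant `648 C₀ η² ≤ εc/4`, `1296(1+2C₀) ≤ εcL`, and far bound
`M L² ≤ ε'K₁²` with `27⁴ε'K₁² ≤ εc²/4`, the near/far majorant is `≤ (3ε/4) S²`. -/
theorem gkb_arith {ε c C₀ η ε' K₁ Lr N nr S T M : ℝ} (hε : 0 < ε) (hc : 0 < c) (hC₀ : 0 ≤ C₀)
    (hLr : 1 ≤ Lr) (hN0 : 0 ≤ N) (hN : N ≤ 27 * Lr ^ 3) (hnr0 : 0 ≤ nr)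
    (hnr : nr ≤ η * Lr) (hS : c * Lr ^ 5 ≤ S) (hη : 648 * C₀ * η ^ 2 ≤ ε * c / 4)
    (hbig : 1296 * (1 + 2 * C₀) ≤ ε * c * Lr) (hM0 : 0 ≤ M) (hM : M * Lr ^ 2 ≤ ε' * K₁ ^ 2)
    (hε' : 27 ^ 4 * ε' * K₁ ^ 2 ≤ ε * c ^ 2 / 4)
    (hT : T ≤ 12 * (N * (1 + C₀ * (nr + 1) ^ 2)) * S + N ^ 4 * M) :
    T ≤ 3 * ε / 4 * S ^ 2 := by
  have hLr0 : 0 < Lr := by linarith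
  have hS0 : 0 ≤ S := le_trans (by positivity) hS
  have hn1 : (nr + 1) ^ 2 ≤ 2 * η ^ 2 * Lr ^ 2 + 2 := by nlinarith [sq_nonneg (η * Lr - 1)]
  -- the near coefficient
  have hcoef : 12 * (N * (1 + C₀ * (nr + 1) ^ 2)) ≤ ε * c / 2 * Lr ^ 5 := by
    have h1 : 324 * (1 + 2 * C₀) ≤ ε * c / 4 * Lr ^ 2 := by nlinarith
    calc 12 * (N * (1 + C₀ * (nr + 1) ^ 2))
        ≤ 12 * ((27 * Lr ^ 3) * (1 + C₀ * (2 * η ^ 2 * Lr ^ 2 + 2))) := by gcongr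
      _ = 324 * (1 + 2 * C₀) * Lr ^ 3 + 648 * C₀ * η ^ 2 * Lr ^ 5 := by ring
      _ ≤ ε * c / 4 * Lr ^ 2 * Lr ^ 3 + ε * c / 4 * Lr ^ 5 :=
          add_le_add (mul_le_mul_of_nonneg_right h1 (by positivity))
            (mul_le_mul_of_nonneg_right hη (by positivity))
      _ = ε * c / 2 * Lr ^ 5 := by ring
  have hnear : 12 * (N * (1 + C₀ * (nr + 1) ^ 2)) * S ≤ ε / 2 * S ^ 2 := by
    have h1 : ε * c / 2 * Lr ^ 5 ≤ ε / 2 * S := by nlinarith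
    calc 12 * (N * (1 + C₀ * (nr + 1) ^ 2)) * S ≤ (ε * c / 2 * Lr ^ 5) * S :=
          mul_le_mul_of_nonneg_right hcoef hS0
      _ ≤ (ε / 2 * S) * S := mul_le_mul_of_nonneg_right h1 hS0
      _ = ε / 2 * S ^ 2 := by ring
  -- the far term
  have hfar : N ^ 4 * M ≤ ε / 4 * S ^ 2 := by
    have hN4 : N ^ 4 ≤ (27 * Lr ^ 3) ^ 4 := pow_le_pow_left₀ hN0 hN 4
    have hS2 : (c * Lr ^ 5) ^ 2 ≤ S ^ 2 := pow_le_pow_left₀ (by positivity) hS 2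
    calc N ^ 4 * M ≤ (27 * Lr ^ 3) ^ 4 * M := mul_le_mul_of_nonneg_right hN4 hM0
      _ = 27 ^ 4 * Lr ^ 10 * (M * Lr ^ 2) := by ring
      _ ≤ 27 ^ 4 * Lr ^ 10 * (ε' * K₁ ^ 2) := mul_le_mul_of_nonneg_left hM (by positivity)
      _ = (27 ^ 4 * ε' * K₁ ^ 2) * Lr ^ 10 := by ring
      _ ≤ (ε * c ^ 2 / 4) * Lr ^ 10 := mul_le_mul_of_nonneg_right hε' (by positivity)
      _ = ε / 4 * (c * Lr ^ 5) ^ 2 := by ring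
      _ ≤ ε / 4 * S ^ 2 := mul_le_mul_of_nonneg_left hS2 (by positivity)
  linarith

/-- `|Σ_a Σ_b Σ_c Σ_e f| ≤ Σ_a Σ_b Σ_c Σ_e |f|`. -/
theorem gkb_abs_sum4_le {ι : Type*} (s : Finset ι) (f : ι → ι → ι → ι → ℝ) :
    |∑ a ∈ s, ∑ b ∈ s, ∑ c ∈ s, ∑ e ∈ s, f a b c e| ≤
      ∑ a ∈ s, ∑ b ∈ s, ∑ c ∈ s, ∑ e ∈ s, |f a b c e| := by
  refine (Finset.abs_sum_le_sum_abs _ _).trans (Finset.sum_le_sum fun a _ => ?_)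
  refine (Finset.abs_sum_le_sum_abs _ _).trans (Finset.sum_le_sum fun b _ => ?_)
  refine (Finset.abs_sum_le_sum_abs _ _).trans (Finset.sum_le_sum fun c _ => ?_)
  exact Finset.abs_sum_le_sum_abs _ _

/-- Six separations `‖yᵢ - yⱼ‖_∞ > ηL` (`i < j`) give all twelve ordered ones. -/
theorem gkb_far_of_six {η : ℝ} {L : ℕ} {y : Fin 4 → Site 3}
    (h01 : η * L < Site.supNorm (y 0 - y 1)) (h02 : η * L < Site.supNorm (y 0 - y 2))
    (h03 : η * L < Site.supNorm (y 0 - y 3)) (h12 : η * L < Site.supNorm (y 1 - y 2))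
    (h13 : η * L < Site.supNorm (y 1 - y 3)) (h23 : η * L < Site.supNorm (y 2 - y 3)) :
    ∀ i j : Fin 4, i ≠ j → η * L < Site.supNorm (y i - y j) := by
  intro i j hij
  fin_cases i <;> fin_cases j <;> first
    | exact absurd rfl hij
    | assumption
    | (rw [Site.supNorm_sub_comm]; assumption)

/-- **Near/far split of `Σ_{Λ_L⁴} |U₄|` at `β_c` on `ℤ^d`, `d ≥ 3`**: there is `C₀ ≥ 0` such that for
all `L n : ℕ` and `M ≥ 0`, if `|U₄(a,b,c,e)| ≤ M` for all `a,b,c,e ∈ Λ_L` at mutual sup-distances `> n`,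
then `Σ_{Λ_L⁴} |U₄| ≤ 12 |Λ_L| (1 + C₀(n+1)²) Σ_{a,b ∈ Λ_L} ⟨σ_aσ_b⟩_{β_c} + |Λ_L|⁴ M` (near
quadruples: `|U₄| ≤ 2⟨σσ⟩⟨σσ⟩` for the pairing containing the close pair,
`abs_criticalUrsellFour_le_two_mul_pair0k`, and the infrared bound on the row sums,
`sum_filter_near_le`; far quadruples: the hypothesis). -/
theorem gkb_sum_abs_ursellFour_le_near_add_far {d : ℕ} (hd : 3 ≤ d) :
    ∃ C₀ : ℝ, 0 ≤ C₀ ∧ ∀ (L n : ℕ) (M : ℝ), 0 ≤ M →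
      (∀ a ∈ box d L, ∀ b ∈ box d L, ∀ c ∈ box d L, ∀ e ∈ box d L,
        n < Site.supNorm (b - a) → n < Site.supNorm (e - c) → n < Site.supNorm (c - a) →
        n < Site.supNorm (e - b) → n < Site.supNorm (e - a) → n < Site.supNorm (c - b) →
        |criticalCorr d 4 ![a, b, c, e] -
          (criticalCorr d 2 ![a, b] * criticalCorr d 2 ![c, e] +
            criticalCorr d 2 ![a, c] * criticalCorr d 2 ![b, e] +
            criticalCorr d 2 ![a, e] * criticalCorr d 2 ![b, c])| ≤ M) →
      ∑ a ∈ box d L, ∑ b ∈ box d L, ∑ c ∈ box d L, ∑ e ∈ box d L,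
        |criticalCorr d 4 ![a, b, c, e] -
          (criticalCorr d 2 ![a, b] * criticalCorr d 2 ![c, e] +
            criticalCorr d 2 ![a, c] * criticalCorr d 2 ![b, e] +
            criticalCorr d 2 ![a, e] * criticalCorr d 2 ![b, c])| ≤
        12 * ((#(box d L) : ℝ) * (1 + C₀ * ((n : ℝ) + 1) ^ 2)) *
            (∑ a ∈ box d L, ∑ b ∈ box d L, criticalCorr d 2 ![a, b]) +
          (#(box d L) : ℝ) ^ 4 * M := by
  classical
  obtain ⟨C, hC0, hIR⟩ := exists_criticalTwoPoint_le_inv_pow hd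
  refine ⟨C * (2 * d * 3 ^ (d - 1)), by positivity, fun L n M hM hfar => ?_⟩
  -- opaque names for the kernels
  obtain ⟨S2, hS2⟩ : ∃ S2 : Site d → Site d → ℝ, ∀ u v, S2 u v = criticalCorr d 2 ![u, v] :=
    ⟨_, fun _ _ => rfl⟩
  obtain ⟨U, hU⟩ : ∃ U : Site d → Site d → Site d → Site d → ℝ, ∀ a b c e, U a b c e =
      criticalCorr d 4 ![a, b, c, e] -
        (criticalCorr d 2 ![a, b] * criticalCorr d 2 ![c, e] +
          criticalCorr d 2 ![a, c] * criticalCorr d 2 ![b, e] +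
          criticalCorr d 2 ![a, e] * criticalCorr d 2 ![b, c]) := ⟨_, fun _ _ _ _ => rfl⟩
  simp only [← hU]
  simp only [← hS2]
  simp only [← hU] at hfar
  set B : Finset (Site d) := box d L with hB
  obtain ⟨V, hV⟩ : ∃ V : ℝ, V = 1 + C * (2 * d * 3 ^ (d - 1)) * ((n : ℝ) + 1) ^ 2 := ⟨_, rfl⟩
  rw [← hV]
  obtain ⟨I, hI⟩ : ∃ I : Site d → Site d → ℝ, ∀ u v,
      I u v = if Site.supNorm (v - u) ≤ n then 2 * S2 u v else 0 := ⟨_, fun _ _ => rfl⟩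
  obtain ⟨Far, hFar⟩ : ∃ Far : Site d → Site d → Site d → Site d → Prop, ∀ a b c e,
      Far a b c e ↔ (n < Site.supNorm (b - a) ∧ n < Site.supNorm (e - c) ∧
        n < Site.supNorm (c - a) ∧ n < Site.supNorm (e - b) ∧ n < Site.supNorm (e - a) ∧
        n < Site.supNorm (c - b)) := ⟨_, fun _ _ _ _ => Iff.rfl⟩
  -- the three pointwise bounds and non-negativity
  have hS2nn : ∀ u v, 0 ≤ S2 u v := fun u v => by rw [hS2]; exact criticalCorr_two_nonneg u v
  have hInn : ∀ u v, 0 ≤ I u v := fun u v => by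
    rw [hI]; split_ifs; exacts [mul_nonneg two_pos.le (hS2nn u v), le_rfl]
  have hP1 : ∀ a b c e, |U a b c e| ≤ 2 * S2 a b * S2 c e := fun a b c e => by
    rw [hU, hS2, hS2]; exact abs_criticalUrsellFour_le_two_mul_pair01 hd a b c e
  have hP2 : ∀ a b c e, |U a b c e| ≤ 2 * S2 a c * S2 b e := fun a b c e => by
    rw [hU, hS2, hS2]; exact abs_criticalUrsellFour_le_two_mul_pair02 hd a b c e
  have hP3 : ∀ a b c e, |U a b c e| ≤ 2 * S2 a e * S2 b c := fun a b c e => by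
    rw [hU, hS2, hS2]; exact abs_criticalUrsellFour_le_two_mul_pair03 hd a b c e
  -- pointwise domination by the seven majorants
  have hpt : ∀ a ∈ B, ∀ b ∈ B, ∀ c ∈ B, ∀ e ∈ B, |U a b c e| ≤
      I a b * S2 c e + S2 a b * I c e + I a c * S2 b e + S2 a c * I b e +
        I a e * S2 b c + S2 a e * I b c + (if Far a b c e then M else 0) := by
    intro a ha b hb c hc e he
    have n1 : 0 ≤ I a b * S2 c e := mul_nonneg (hInn a b) (hS2nn c e)
    have n2 : 0 ≤ S2 a b * I c e := mul_nonneg (hS2nn a b) (hInn c e)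
    have n3 : 0 ≤ I a c * S2 b e := mul_nonneg (hInn a c) (hS2nn b e)
    have n4 : 0 ≤ S2 a c * I b e := mul_nonneg (hS2nn a c) (hInn b e)
    have n5 : 0 ≤ I a e * S2 b c := mul_nonneg (hInn a e) (hS2nn b c)
    have n6 : 0 ≤ S2 a e * I b c := mul_nonneg (hS2nn a e) (hInn b c)
    have n7 : 0 ≤ (if Far a b c e then M else 0) := by split_ifs <;> linarith
    by_cases h1 : Site.supNorm (b - a) ≤ n
    · have e1 : I a b * S2 c e = 2 * S2 a b * S2 c e := by rw [hI, if_pos h1]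
      linarith [hP1 a b c e]
    by_cases h2 : Site.supNorm (e - c) ≤ n
    · have e2 : S2 a b * I c e = 2 * S2 a b * S2 c e := by rw [hI, if_pos h2]; ring
      linarith [hP1 a b c e]
    by_cases h3 : Site.supNorm (c - a) ≤ n
    · have e3 : I a c * S2 b e = 2 * S2 a c * S2 b e := by rw [hI, if_pos h3]
      linarith [hP2 a b c e]
    by_cases h4 : Site.supNorm (e - b) ≤ n
    · have e4 : S2 a c * I b e = 2 * S2 a c * S2 b e := by rw [hI, if_pos h4]; ring
      linarith [hP2 a b c e]
    by_cases h5 : Site.supNorm (e - a) ≤ n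
    · have e5 : I a e * S2 b c = 2 * S2 a e * S2 b c := by rw [hI, if_pos h5]
      linarith [hP3 a b c e]
    by_cases h6 : Site.supNorm (c - b) ≤ n
    · have e6 : S2 a e * I b c = 2 * S2 a e * S2 b c := by rw [hI, if_pos h6]; ring
      linarith [hP3 a b c e]
    have hF : Far a b c e := (hFar a b c e).2
      ⟨not_le.1 h1, not_le.1 h2, not_le.1 h3, not_le.1 h4, not_le.1 h5, not_le.1 h6⟩
    have e7 : (if Far a b c e then M else 0) = M := if_pos hF
    have hM' := hfar a ha b hb c hc e he (not_le.1 h1) (not_le.1 h2) (not_le.1 h3) (not_le.1 h4)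
      (not_le.1 h5) (not_le.1 h6)
    linarith
  -- the row sums of the near kernel
  have hrow : ∀ u, ∑ v ∈ B, I u v ≤ 2 * V := by
    intro u
    simp only [hI]
    rw [← Finset.sum_filter, ← Finset.mul_sum]
    refine mul_le_mul_of_nonneg_left ?_ two_pos.le
    have h := sum_filter_near_le hd (criticalTwoPoint_nonneg' (d := d)) criticalTwoPoint_le_one'
      hC0 hIR (B.filter fun v => Site.supNorm (v - u) ≤ n) u n
      (fun v hv => (Finset.mem_filter.1 hv).2)
    have e : ∑ v ∈ B.filter (fun v => Site.supNorm (v - u) ≤ n), S2 u v =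
        ∑ v ∈ B.filter (fun v => Site.supNorm (v - u) ≤ n), criticalTwoPoint d (u - v) :=
      Finset.sum_congr rfl fun v _ => by rw [hS2, criticalCorr_two_pair, criticalTwoPoint_sub_comm]
    rw [e, hV]
    refine h.trans (le_of_eq ?_)
    ring
  have hIIle : ∑ u ∈ B, ∑ v ∈ B, I u v ≤ (#B : ℝ) * (2 * V) := by
    calc ∑ u ∈ B, ∑ v ∈ B, I u v ≤ ∑ _u ∈ B, 2 * V := Finset.sum_le_sum fun u _ => hrow u
      _ = (#B : ℝ) * (2 * V) := by rw [Finset.sum_const, nsmul_eq_mul]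
  have hXS : (∑ u ∈ B, ∑ v ∈ B, I u v) * (∑ a ∈ B, ∑ b ∈ B, S2 a b) ≤
      (#B : ℝ) * (2 * V) * (∑ a ∈ B, ∑ b ∈ B, S2 a b) := mul_le_mul_of_nonneg_right hIIle
    (Finset.sum_nonneg fun a _ => Finset.sum_nonneg fun b _ => hS2nn a b)
  -- the far majorant
  have h7 : ∑ a ∈ B, ∑ b ∈ B, ∑ c ∈ B, ∑ e ∈ B, (if Far a b c e then M else 0) ≤
      (#B : ℝ) ^ 4 * M := by
    calc ∑ a ∈ B, ∑ b ∈ B, ∑ c ∈ B, ∑ e ∈ B, (if Far a b c e then M else 0)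
        ≤ ∑ _a ∈ B, ∑ _b ∈ B, ∑ _c ∈ B, ∑ _e ∈ B, M :=
          Finset.sum_le_sum fun a _ => Finset.sum_le_sum fun b _ => Finset.sum_le_sum fun c _ =>
            Finset.sum_le_sum fun e _ => by split_ifs <;> linarith
      _ = (#B : ℝ) ^ 4 * M := by simp only [Finset.sum_const, nsmul_eq_mul]; ring
  -- summation
  calc ∑ a ∈ B, ∑ b ∈ B, ∑ c ∈ B, ∑ e ∈ B, |U a b c e|
      ≤ ∑ a ∈ B, ∑ b ∈ B, ∑ c ∈ B, ∑ e ∈ B,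
          (I a b * S2 c e + S2 a b * I c e + I a c * S2 b e + S2 a c * I b e +
            I a e * S2 b c + S2 a e * I b c + (if Far a b c e then M else 0)) :=
        Finset.sum_le_sum fun a ha => Finset.sum_le_sum fun b hb => Finset.sum_le_sum fun c hc =>
          Finset.sum_le_sum fun e he => hpt a ha b hb c hc e he
    _ = (∑ u ∈ B, ∑ v ∈ B, I u v) * (∑ a ∈ B, ∑ b ∈ B, S2 a b) +
          (∑ a ∈ B, ∑ b ∈ B, S2 a b) * (∑ u ∈ B, ∑ v ∈ B, I u v) +
          (∑ u ∈ B, ∑ v ∈ B, I u v) * (∑ a ∈ B, ∑ b ∈ B, S2 a b) +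
          (∑ a ∈ B, ∑ b ∈ B, S2 a b) * (∑ u ∈ B, ∑ v ∈ B, I u v) +
          (∑ u ∈ B, ∑ v ∈ B, I u v) * (∑ a ∈ B, ∑ b ∈ B, S2 a b) +
          (∑ a ∈ B, ∑ b ∈ B, S2 a b) * (∑ u ∈ B, ∑ v ∈ B, I u v) +
          ∑ a ∈ B, ∑ b ∈ B, ∑ c ∈ B, ∑ e ∈ B, (if Far a b c e then M else 0) := by
        simp only [Finset.sum_add_distrib]
        rw [sum_sum_sum_sum_mul_pair01 B I S2, sum_sum_sum_sum_mul_pair01 B S2 I,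
          sum_sum_sum_sum_mul_pair02 B I S2, sum_sum_sum_sum_mul_pair02 B S2 I,
          sum_sum_sum_sum_mul_pair03 B I S2, sum_sum_sum_sum_mul_pair03 B S2 I]
    _ ≤ 12 * ((#B : ℝ) * V) * (∑ a ∈ B, ∑ b ∈ B, S2 a b) + (#B : ℝ) ^ 4 * M := by
        nlinarith [hXS, h7]

/-- S7 — A GAUSSIAN LIMIT KILLS THE BLOCK BINDER COUPLING (route LeeYangGap support 4950, in the form
this line needs: two-sided `L⁵` block variance given, no scale covariance): if `c L⁵ ≤ Σ_L ≤ C L⁵` and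
`(ρ, S)` is a non-degenerate pointwise scaling limit of `criticalCorr 3` with `U₄^S ≡ 0` on non-coincident
configurations, then `g_L = (3Σ_L² - ⟨M_L⁴⟩)/Σ_L² → 0`. (`3Σ_L² - ⟨M_L⁴⟩ = -Σ_{box⁴} U₄^{lat}`;
`|U₄^{lat}| ≤ 2·S₂S₂` for each pairing, `abs_criticalUrsellFour_le_two_mul`; ε-separated configurations
by uniform convergence on the compact `K_ε ⊂ NonCoincident` with `ρ(1/L)⁻⁴ ≲ L⁻²`
(`exists_eventually_inv_sq_rho_le`); ε-close ones by `Σ_{‖z‖ ≤ εL} G(z) ≲ ε²L²` (infrared bound) times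
`Σ_L`, against `Σ_L² ≳ L⁵ Σ_L`.) -/
theorem stub_gaussianKillsBinder :
    (∃ c C : ℝ, 0 < c ∧ ∀ L : ℕ, 1 ≤ L →
        c * (L : ℝ) ^ 5 ≤ plusExpect 3 (criticalBeta 3) 0 (fun σ => (∑ x ∈ box 3 L, spinAt x σ) ^ 2) ∧
        plusExpect 3 (criticalBeta 3) 0 (fun σ => (∑ x ∈ box 3 L, spinAt x σ) ^ 2) ≤ C * (L : ℝ) ^ 5) →
    ∀ (ρ : ℝ → ℝ) (S : CorrFamily 3), (∀ δ ∈ Set.Ioc (0:ℝ) 1, 0 < ρ δ) →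
      HasPointwiseScalingLimit (criticalCorr 3) ρ S → IsNondegenerateTwoPoint S →
      ¬ HasNontrivialU4 S →
      Tendsto (fun L : ℕ =>
        (3 * (plusExpect 3 (criticalBeta 3) 0 (fun σ => (∑ x ∈ box 3 L, spinAt x σ) ^ 2)) ^ 2 -
            plusExpect 3 (criticalBeta 3) 0 (fun σ => (∑ x ∈ box 3 L, spinAt x σ) ^ 4)) /
          (plusExpect 3 (criticalBeta 3) 0 (fun σ => (∑ x ∈ box 3 L, spinAt x σ) ^ 2)) ^ 2)
        atTop (𝓝 0) := by
  rintro ⟨c, _, hc, hV⟩ ρ S _ hlim hnd hU4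
  classical
  -- notation: `Sg L = Σ_L`, the lattice Ursell function `U`
  obtain ⟨Sg, hSg⟩ : ∃ Sg : ℕ → ℝ, ∀ L, Sg L =
      plusExpect 3 (criticalBeta 3) 0 (fun σ => (∑ x ∈ box 3 L, spinAt x σ) ^ 2) := ⟨_, fun _ => rfl⟩
  obtain ⟨U, hU⟩ : ∃ U : Site 3 → Site 3 → Site 3 → Site 3 → ℝ, ∀ a b c e, U a b c e =
      criticalCorr 3 4 ![a, b, c, e] -
        (criticalCorr 3 2 ![a, b] * criticalCorr 3 2 ![c, e] +
          criticalCorr 3 2 ![a, c] * criticalCorr 3 2 ![b, e] +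
          criticalCorr 3 2 ![a, e] * criticalCorr 3 2 ![b, c]) := ⟨_, fun _ _ _ _ => rfl⟩
  -- the numerator is `-Σ U` and `|numerator| ≤ Σ |U|`
  have hnum : ∀ L : ℕ, |3 * Sg L ^ 2 -
      plusExpect 3 (criticalBeta 3) 0 (fun σ => (∑ x ∈ box 3 L, spinAt x σ) ^ 4)| ≤
      ∑ a ∈ box 3 L, ∑ b ∈ box 3 L, ∑ c' ∈ box 3 L, ∑ e ∈ box 3 L, |U a b c' e| := by
    intro L
    rw [hSg, three_mul_sq_sub_fourth_eq_neg_sum_ursellFour 3 L, abs_neg]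
    simp only [← hU]
    exact gkb_abs_sum4_le _ _
  -- inputs: near/far split, far smallness, the size of `ρ`
  obtain ⟨C₀, hC₀, hNF⟩ := gkb_sum_abs_ursellFour_le_near_add_far (d := 3) le_rfl
  have hz₀ : (![(0 : EuclideanSpace ℝ (Fin 3)), EuclideanSpace.single 0 1] :
      Fin 2 → EuclideanSpace ℝ (Fin 3)) ∈ NonCoincident 3 2 := by
    refine pair_mem_nonCoincident fun h => ?_
    have := congrArg (fun v : EuclideanSpace ℝ (Fin 3) => v 0) h
    simp at this
  obtain ⟨K₁, hK₁⟩ := exists_eventually_inv_sq_rho_le (d := 3) le_rfl hlim hz₀ (hnd _ hz₀)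
  rw [Metric.tendsto_nhds]
  intro ε hε
  -- the two auxiliary smallness parameters
  obtain ⟨η, hηdef⟩ : ∃ η : ℝ, η = min 1 (ε * c / (4 * 648 * C₀ + 4)) := ⟨_, rfl⟩
  have hηpos : 0 < η := by rw [hηdef]; exact lt_min one_pos (by positivity)
  have hη1 : η ≤ 1 := by rw [hηdef]; exact min_le_left _ _
  have hηle : η ≤ ε * c / (4 * 648 * C₀ + 4) := by rw [hηdef]; exact min_le_right _ _
  have hηsq : 648 * C₀ * η ^ 2 ≤ ε * c / 4 := by
    have h1 : η ^ 2 ≤ η := by nlinarith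
    have h2 : η * (4 * 648 * C₀ + 4) ≤ ε * c := by rwa [le_div_iff₀ (by positivity)] at hηle
    nlinarith
  obtain ⟨ε', hε'def⟩ : ∃ ε' : ℝ, ε' = ε * c ^ 2 / (4 * 27 ^ 4 * (K₁ ^ 2 + 1)) := ⟨_, rfl⟩
  have hε'pos : 0 < ε' := by rw [hε'def]; positivity
  have hε'le : 27 ^ 4 * ε' * K₁ ^ 2 ≤ ε * c ^ 2 / 4 := by
    have hD : (0 : ℝ) < 4 * 27 ^ 4 * (K₁ ^ 2 + 1) := by positivity
    have e : (27 : ℝ) ^ 4 * (ε * c ^ 2 / (4 * 27 ^ 4 * (K₁ ^ 2 + 1))) * K₁ ^ 2 =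
        ε * c ^ 2 / 4 * (K₁ ^ 2 / (K₁ ^ 2 + 1)) := by
      field_simp
    rw [hε'def, e]
    have hfrac : K₁ ^ 2 / (K₁ ^ 2 + 1) ≤ 1 := by
      rw [div_le_one (by positivity)]; linarith
    calc ε * c ^ 2 / 4 * (K₁ ^ 2 / (K₁ ^ 2 + 1)) ≤ ε * c ^ 2 / 4 * 1 :=
          mul_le_mul_of_nonneg_left hfrac (by positivity)
      _ = ε * c ^ 2 / 4 := mul_one _
  -- eventual facts along `L → ∞`
  have hfarL := eventually_forall_far_rescaled_ursellFour_le (d := 3) le_rfl hlim hU4 hηpos hε'pos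
  have hδ : Tendsto (fun L : ℕ => 1 / (L : ℝ)) atTop (𝓝[>] (0 : ℝ)) := by
    rw [tendsto_nhdsWithin_iff]
    refine ⟨tendsto_one_div_atTop_nhds_zero_nat, ?_⟩
    filter_upwards [eventually_ge_atTop 1] with L hL
    have : (0 : ℝ) < L := by exact_mod_cast hL
    exact Set.mem_Ioi.2 (by positivity)
  have hρL := hδ.eventually hK₁
  have hbigL : ∀ᶠ L : ℕ in atTop, 1296 * (1 + 2 * C₀) / (ε * c) ≤ (L : ℝ) :=
    tendsto_natCast_atTop_atTop.eventually_ge_atTop _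
  filter_upwards [hfarL, hρL, hbigL, eventually_ge_atTop 1] with L hfar hρ hbig hL1
  rw [Real.dist_eq, sub_zero]
  -- real bookkeeping at this `L`
  have hLr : (1 : ℝ) ≤ L := by exact_mod_cast hL1
  have hLr0 : (0 : ℝ) < L := by positivity
  obtain ⟨hρ2, hρinv⟩ := hρ
  have hρinv' : (ρ (1 / (L : ℝ)) ^ 2)⁻¹ ≤ K₁ * (1 / (L : ℝ)) := by simpa using hρinv
  have hS : c * (L : ℝ) ^ 5 ≤ Sg L := by rw [hSg]; exact (hV L hL1).1
  have hSpos : 0 < Sg L := lt_of_lt_of_le (by positivity) hS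
  have hbig' : 1296 * (1 + 2 * C₀) ≤ ε * c * L := by
    have h := (div_le_iff₀ (by positivity)).1 hbig
    linarith
  -- the far bound `M`
  obtain ⟨M, hMdef⟩ : ∃ M : ℝ, M = ε' * (K₁ * (1 / (L : ℝ))) ^ 2 := ⟨_, rfl⟩
  have hM0 : 0 ≤ M := by rw [hMdef]; positivity
  have hML : M * (L : ℝ) ^ 2 ≤ ε' * K₁ ^ 2 := by
    have hL0 : (L : ℝ) ≠ 0 := hLr0.ne'
    have e : (K₁ * (1 / (L : ℝ))) ^ 2 * (L : ℝ) ^ 2 = K₁ ^ 2 := by field_simp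
    rw [hMdef, mul_assoc, e]
  set n : ℕ := ⌊η * L⌋₊ with hn
  have hnr0 : (0 : ℝ) ≤ n := Nat.cast_nonneg n
  have hnr : (n : ℝ) ≤ η * L := Nat.floor_le (by positivity)
  have hconv : ∀ u v : Site 3, n < Site.supNorm (v - u) →
      η * L < Site.supNorm (u - v) ∧ η * L < Site.supNorm (v - u) := by
    intro u v h
    have h' : (n : ℝ) + 1 ≤ Site.supNorm (v - u) := by exact_mod_cast h
    have hfl : η * L < (n : ℝ) + 1 := Nat.lt_floor_add_one _
    rw [Site.supNorm_sub_comm u v]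
    exact ⟨by linarith, by linarith⟩
  have hfarM : ∀ a ∈ box 3 L, ∀ b ∈ box 3 L, ∀ c' ∈ box 3 L, ∀ e ∈ box 3 L,
      n < Site.supNorm (b - a) → n < Site.supNorm (e - c') → n < Site.supNorm (c' - a) →
      n < Site.supNorm (e - b) → n < Site.supNorm (e - a) → n < Site.supNorm (c' - b) →
      |criticalCorr 3 4 ![a, b, c', e] -
        (criticalCorr 3 2 ![a, b] * criticalCorr 3 2 ![c', e] +
          criticalCorr 3 2 ![a, c'] * criticalCorr 3 2 ![b, e] +
          criticalCorr 3 2 ![a, e] * criticalCorr 3 2 ![b, c'])| ≤ M := by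
    intro a ha b hb c' hc e he h1 h2 h3 h4 h5 h6
    have hy := hfar ![a, b, c', e] (fun i => by fin_cases i <;> assumption)
      (gkb_far_of_six (by simpa using (hconv _ _ h1).1) (by simpa using (hconv _ _ h3).1)
        (by simpa using (hconv _ _ h5).1) (by simpa using (hconv _ _ h6).1)
        (by simpa using (hconv _ _ h4).1) (by simpa using (hconv _ _ h2).1))
    simp only [Matrix.cons_val_zero, Matrix.cons_val_one, Matrix.cons_val] at hy
    -- `hy : ρ(1/L)⁴ |U| ≤ ε'`
    have hρ4eq : ρ (1 / (L : ℝ)) ^ 4 = (ρ (1 / (L : ℝ)) ^ 2) ^ 2 := by ring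
    have hρ4 : 0 < ρ (1 / (L : ℝ)) ^ 4 := by rw [hρ4eq]; exact pow_pos hρ2 2
    have hinv4 : (ρ (1 / (L : ℝ)) ^ 4)⁻¹ ≤ (K₁ * (1 / (L : ℝ))) ^ 2 := by
      rw [hρ4eq, ← inv_pow]
      exact pow_le_pow_left₀ (inv_nonneg.2 hρ2.le) hρinv' 2
    rw [hMdef]
    calc _ = (ρ (1 / (L : ℝ)) ^ 4)⁻¹ * (ρ (1 / (L : ℝ)) ^ 4 * |criticalCorr 3 4 ![a, b, c', e] -
          (criticalCorr 3 2 ![a, b] * criticalCorr 3 2 ![c', e] +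
            criticalCorr 3 2 ![a, c'] * criticalCorr 3 2 ![b, e] +
            criticalCorr 3 2 ![a, e] * criticalCorr 3 2 ![b, c'])|) := by
          rw [← mul_assoc, inv_mul_cancel₀ hρ4.ne', one_mul]
      _ ≤ (K₁ * (1 / (L : ℝ))) ^ 2 * ε' :=
          mul_le_mul hinv4 hy (by positivity) (by positivity)
      _ = ε' * (K₁ * (1 / (L : ℝ))) ^ 2 := mul_comm _ _
  -- the near/far split at this `L`
  have hT := hNF L n M hM0 hfarM
  simp only [← hU] at hT
  rw [← plusExpect_blockSpin_sq_eq_sum 3 L, ← hSg] at hT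
  have hN : ((#(box 3 L) : ℕ) : ℝ) ≤ 27 * (L : ℝ) ^ 3 := by
    rw [card_box]
    push_cast
    calc (2 * (L : ℝ) + 1) ^ 3 ≤ (3 * L) ^ 3 := pow_le_pow_left₀ (by positivity) (by linarith) 3
      _ = 27 * (L : ℝ) ^ 3 := by ring
  have hTle := gkb_arith hε hc hC₀ hLr (Nat.cast_nonneg _) hN hnr0 hnr hS hηsq hbig' hM0 hML
    hε'le hT
  -- conclusion
  rw [← hSg, abs_div, abs_of_pos (pow_pos hSpos 2), div_lt_iff₀ (pow_pos hSpos 2)]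
  have hS2pos : 0 < Sg L ^ 2 := pow_pos hSpos 2
  calc |3 * Sg L ^ 2 - plusExpect 3 (criticalBeta 3) 0 (fun σ => (∑ x ∈ box 3 L, spinAt x σ) ^ 4)|
      ≤ ∑ a ∈ box 3 L, ∑ b ∈ box 3 L, ∑ c' ∈ box 3 L, ∑ e ∈ box 3 L, |U a b c' e| := hnum L
    _ ≤ 3 * ε / 4 * Sg L ^ 2 := hTle
    _ < ε * Sg L ^ 2 := by nlinarith

end Summit.CriticalPhenomena.Ising3DConformalLimit.PerfectScreeningCoulombImpliesNontrivial

end
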